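import Summits.CriticalPhenomena.PercolationContinuityZ3.Theorems.PercNearOneGluingNoHeavyLowerTailKNGoodTwoTwoStars
import HarnessLib

/-!
# Corners of the `2+2` torus with a SHARED port, at goodness strength (forced-star coordinates)
# (`NoHeavyLowerTail` cell, stmt-CriticalPhenomena-4575; prover `prim-hp-2`, deletion–contraction line, gen 8)

Support file (`--supports stmt-CriticalPhenomena-4575`).  No definitions, no named facts, no sorries.

Configuration (α) of the cell's lead memo (LEAD-GEN7 §3e): two pendant two-port stars `x – {p₁, p₂}` and `y – {p₁, q}` SHARING the port `p₁`,
arbitrary core `K` (here with the observer `o` isolated; `G T` = forced-star margin of `o` glued to `T`, as in `UpsetExchange.arcCorner`),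
`KP := K[s(p₁,p₂) ↦ 1]`, `KQ := K[s(p₁,q) ↦ 1]`, `KPQ` both; split row of `z`: `(1−u)(1−v)(z−j)_K + u(1−v)(z−j)_{KP} + (1−u)v(z−j)_{KQ} + uv(z−j)_{KPQ}`.
Because the two units share `p₁`, every jointly glued block is a separately glued one, and the corners are elementary:
* `KNGoodTwoTwo.pCornerShared`     — `y` sure at the shared port: the corner IS the row of `p₁`.
* `KNGoodTwoTwo.mixedCornerShared` — `y` sure at `q`, `x` all-or-nothing: `(1−u)((1−v)G{q} + vG{q,p₁}) + u·G{q,p₁,p₂} ≥ 0` from the row of `q`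
  (`UpsetExchange.twoAtomGlue` on `K` with `s(p₁,q)` raised by `v`; the glue pair of the lemma is `s(q,p₁)` itself).
* `KNGoodTwoTwo.ffCornerShared`    — both units all-or-nothing, with the goodness deficit: `(1−u)(1−v)(μ_K(r↔b) − μ_K(j↔b)) + u(1−v)G{p₁,p₂} + (1−u)vG{p₁,q}
  + uv·G{q,p₁,p₂} ≥ 0` from the row of the `K`-minimiser `r` (three gluing transfers, Kozma–Nitzan Lemma 5; no final merge).
-/

namespace Summit.CriticalPhenomena.PercolationContinuityZ3.Theorems

open MeasureTheory Set ProbabilityTheory Literature.Probability.LatticeModels Literature.Probability.Percolation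

noncomputable section
open Classical

namespace KNGoodTwoTwo
open UpsetExchange KNGoodAux KNGoodSeries KNGoodHair KNGoodLoser

variable {n : ℕ}

/-- **Shared-port corner, `y` sure at the shared port**: the corner is the row of `p₁`. [cite: KozmaNitzan2024, Lemma 5 (p. 13)] -/
theorem pCornerShared (K : Sym2 (Fin n) → unitInterval) (o p₁ p₂ q j b : Fin n) (u v : unitInterval)
    (hp : p₁ ≠ p₂) (h1 : p₁ ≠ q) (h2 : p₂ ≠ q) (hop₁ : o ≠ p₁) (hop₂ : o ≠ p₂) (hoq : o ≠ q) (hjo : j ≠ o) (hbo : b ≠ o)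
    (hisoK : ∀ u' : Fin n, u' ≠ o → K s(o, u') = 0)
    (G : Finset (Fin n) → ℝ)
    (hG : ∀ T : Finset (Fin n), G T =
      (prodBernoulli (fun f : Sym2 (Fin n) => if f ∈ T.image (fun t => s(o, t)) then 1 else K f)).real (openConn o b) -
        (prodBernoulli (fun f : Sym2 (Fin n) => if f ∈ T.image (fun t => s(o, t)) then 1 else K f)).real (openConn j b))
    (hrow : 0 ≤ (1 - (u : ℝ)) * (1 - (v : ℝ)) * ((prodBernoulli K).real (openConn p₁ b) - (prodBernoulli K).real (openConn j b)) +
      (u : ℝ) * (1 - (v : ℝ)) * ((prodBernoulli (fun f : Sym2 (Fin n) => if f = s(p₁, p₂) then 1 else K f)).real (openConn p₁ b) -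
        (prodBernoulli (fun f : Sym2 (Fin n) => if f = s(p₁, p₂) then 1 else K f)).real (openConn j b)) +
      (1 - (u : ℝ)) * (v : ℝ) * ((prodBernoulli (fun f : Sym2 (Fin n) => if f = s(p₁, q) then 1 else K f)).real (openConn p₁ b) -
        (prodBernoulli (fun f : Sym2 (Fin n) => if f = s(p₁, q) then 1 else K f)).real (openConn j b)) +
      (u : ℝ) * (v : ℝ) * ((prodBernoulli (fun f : Sym2 (Fin n) => if f = s(p₁, p₂) then 1 else if f = s(p₁, q) then 1 else K f)).real (openConn p₁ b) -
        (prodBernoulli (fun f : Sym2 (Fin n) => if f = s(p₁, p₂) then 1 else if f = s(p₁, q) then 1 else K f)).real (openConn j b))) :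
    0 ≤ (1 - (u : ℝ)) * ((1 - (v : ℝ)) * G {p₁} + (v : ℝ) * G {p₁, q}) +
      (u : ℝ) * ((1 - (v : ℝ)) * G {p₁, p₂} + (v : ℝ) * G {q, p₁, p₂}) := by
  set eP : Sym2 (Fin n) := s(p₁, p₂) with heP
  set eQ : Sym2 (Fin n) := s(p₁, q) with heQ
  have hPQne : eP ≠ eQ := fun h => h2 (Sym2.congr_right.1 (heP ▸ heQ ▸ h))
  have hG0 : G {p₁} = (prodBernoulli K).real (openConn p₁ b) - (prodBernoulli K).real (openConn j b) := by
    have h := forcedMargin_eq K o b j hisoK hbo hjo {p₁} (by simp [hop₁]) p₁ (by simp) ∅ (by simp) (by simp)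
    rw [hG, h]; simp
  have hG1 : G {p₁, p₂} = (prodBernoulli (fun f : Sym2 (Fin n) => if f = eP then 1 else K f)).real (openConn p₁ b) -
      (prodBernoulli (fun f : Sym2 (Fin n) => if f = eP then 1 else K f)).real (openConn j b) := by
    have h := forcedMargin_eq K o b j hisoK hbo hjo {p₁, p₂} (by simp [hop₁, hop₂]) p₁ (by simp) {eP}
      (by intro e he x hx; rw [Finset.mem_singleton] at he; subst he; rw [heP] at hx
          rcases Sym2.mem_iff.1 hx with rfl | rfl <;> simp)
      (by intro t ht; simp only [Finset.mem_insert, Finset.mem_singleton] at ht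
          rcases ht with rfl | rfl
          · exact Or.inl rfl
          · exact Or.inr (Or.inl (by rw [heP]; simp)))
    rw [hG, h]; simp
  have hG2 : G {p₁, q} = (prodBernoulli (fun f : Sym2 (Fin n) => if f = eQ then 1 else K f)).real (openConn p₁ b) -
      (prodBernoulli (fun f : Sym2 (Fin n) => if f = eQ then 1 else K f)).real (openConn j b) := by
    have h := forcedMargin_eq K o b j hisoK hbo hjo {p₁, q} (by simp [hop₁, hoq]) p₁ (by simp) {eQ}
      (by intro e he x hx; rw [Finset.mem_singleton] at he; subst he; rw [heQ] at hx
          rcases Sym2.mem_iff.1 hx with rfl | rfl <;> simp)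
      (by intro t ht; simp only [Finset.mem_insert, Finset.mem_singleton] at ht
          rcases ht with rfl | rfl
          · exact Or.inl rfl
          · exact Or.inr (Or.inl (by rw [heQ]; simp)))
    rw [hG, h]; simp
  have hG3 : G {q, p₁, p₂} = (prodBernoulli (fun f : Sym2 (Fin n) => if f = eP then 1 else if f = eQ then 1 else K f)).real (openConn p₁ b) -
      (prodBernoulli (fun f : Sym2 (Fin n) => if f = eP then 1 else if f = eQ then 1 else K f)).real (openConn j b) := by
    have h := forcedMargin_eq K o b j hisoK hbo hjo {q, p₁, p₂} (by simp [hop₁, hop₂, hoq]) p₁ (by simp) {eP, eQ}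
      (by intro e he x hx; simp only [Finset.mem_insert, Finset.mem_singleton] at he
          rcases he with rfl | rfl
          · rw [heP] at hx; rcases Sym2.mem_iff.1 hx with rfl | rfl <;> simp
          · rw [heQ] at hx; rcases Sym2.mem_iff.1 hx with rfl | rfl <;> simp)
      (by intro t ht; simp only [Finset.mem_insert, Finset.mem_singleton] at ht
          rcases ht with rfl | rfl | rfl
          · exact Or.inr (Or.inl (by rw [heQ]; simp))
          · exact Or.inl rfl
          · exact Or.inr (Or.inl (by rw [heP]; simp)))
    have e : (fun f : Sym2 (Fin n) => if f ∈ ({eP, eQ} : Finset (Sym2 (Fin n))) then (1 : unitInterval) else K f) =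
        fun f => if f = eP then 1 else if f = eQ then 1 else K f := by
      funext f; simp only [Finset.mem_insert, Finset.mem_singleton]
      by_cases h1 : f = eP
      · simp [h1]
      · by_cases h2 : f = eQ
        · simp [h2, hPQne.symm]
        · simp [h1, h2]
    rw [hG, h, e]
  rw [hG0, hG1, hG2, hG3]
  nlinarith [hrow, u.2.1, u.2.2, v.2.1, v.2.2]

/-- **Shared-port MIXED corner** (`y` sure at `q`, the unit of `x` all-or-nothing).  See the module docstring.
[cite: KozmaNitzan2024, Lemma 5 and Lemma 3(i) (pp. 6, 13); VandenbergHaggstromKahn2005, Thm. 1.2] -/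
theorem mixedCornerShared (K : Sym2 (Fin n) → unitInterval) (o p₁ p₂ q j b : Fin n) (u v : unitInterval)
    (hp : p₁ ≠ p₂) (h1 : p₁ ≠ q) (h2 : p₂ ≠ q) (hop₁ : o ≠ p₁) (hop₂ : o ≠ p₂) (hoq : o ≠ q) (hjo : j ≠ o) (hbo : b ≠ o)
    (hisoK : ∀ u' : Fin n, u' ≠ o → K s(o, u') = 0)
    (G : Finset (Fin n) → ℝ)
    (hG : ∀ T : Finset (Fin n), G T =
      (prodBernoulli (fun f : Sym2 (Fin n) => if f ∈ T.image (fun t => s(o, t)) then 1 else K f)).real (openConn o b) -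
        (prodBernoulli (fun f : Sym2 (Fin n) => if f ∈ T.image (fun t => s(o, t)) then 1 else K f)).real (openConn j b))
    (hrow : 0 ≤ (1 - (u : ℝ)) * (1 - (v : ℝ)) * ((prodBernoulli K).real (openConn q b) - (prodBernoulli K).real (openConn j b)) +
      (u : ℝ) * (1 - (v : ℝ)) * ((prodBernoulli (fun f : Sym2 (Fin n) => if f = s(p₁, p₂) then 1 else K f)).real (openConn q b) -
        (prodBernoulli (fun f : Sym2 (Fin n) => if f = s(p₁, p₂) then 1 else K f)).real (openConn j b)) +
      (1 - (u : ℝ)) * (v : ℝ) * ((prodBernoulli (fun f : Sym2 (Fin n) => if f = s(p₁, q) then 1 else K f)).real (openConn q b) -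
        (prodBernoulli (fun f : Sym2 (Fin n) => if f = s(p₁, q) then 1 else K f)).real (openConn j b)) +
      (u : ℝ) * (v : ℝ) * ((prodBernoulli (fun f : Sym2 (Fin n) => if f = s(p₁, p₂) then 1 else if f = s(p₁, q) then 1 else K f)).real (openConn q b) -
        (prodBernoulli (fun f : Sym2 (Fin n) => if f = s(p₁, p₂) then 1 else if f = s(p₁, q) then 1 else K f)).real (openConn j b))) :
    0 ≤ (1 - (u : ℝ)) * ((1 - (v : ℝ)) * G {q} + (v : ℝ) * G {q, p₁}) + (u : ℝ) * G {q, p₁, p₂} := by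
  set eP : Sym2 (Fin n) := s(p₁, p₂) with heP
  set eQ : Sym2 (Fin n) := s(p₁, q) with heQ
  set P : Finset (Fin n) := {p₁, p₂} with hPdef
  have hPQne : eP ≠ eQ := fun h => h2 (Sym2.congr_right.1 (heP ▸ heQ ▸ h))
  have hqP : q ∉ P := by rw [hPdef]; simp [h1.symm, h2.symm]
  have hp₁P : p₁ ∈ P := by rw [hPdef]; simp
  have hglueP : ∀ g : Sym2 (Fin n) → unitInterval,
      (fun f : Sym2 (Fin n) => if (∀ x ∈ f, x ∈ P) ∧ ¬ f.IsDiag then (1 : unitInterval) else g f) = fun f => if f = eP then 1 else g f :=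
    fun g => glue_pair_eq g hp
  set Kv : Sym2 (Fin n) → unitInterval := fun f => if f = eQ then Set.Icc.convexComb (K eQ) 1 v else K f with hKv
  set KQf : Sym2 (Fin n) → unitInterval := fun f => if f = eQ then 1 else K f with hKQf
  set KPf : Sym2 (Fin n) → unitInterval := fun f => if f = eP then 1 else K f with hKPf
  set KPQf : Sym2 (Fin n) → unitInterval := fun f => if f = eP then 1 else if f = eQ then 1 else K f with hKPQf
  have hsplit0 : ∀ z, (prodBernoulli Kv).real (openConn z b) =
      (1 - (v : ℝ)) * (prodBernoulli K).real (openConn z b) + (v : ℝ) * (prodBernoulli KQf).real (openConn z b) :=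
    fun z => real_raisePair_eq_mix K eQ v (openConn z b)
  have hsplitP : ∀ z, (prodBernoulli (fun f : Sym2 (Fin n) => if (∀ x ∈ f, x ∈ P) ∧ ¬ f.IsDiag then 1 else Kv f)).real (openConn z b) =
      (1 - (v : ℝ)) * (prodBernoulli KPf).real (openConn z b) + (v : ℝ) * (prodBernoulli KPQf).real (openConn z b) := by
    intro z
    have e1 : (fun f : Sym2 (Fin n) => if (∀ x ∈ f, x ∈ P) ∧ ¬ f.IsDiag then (1 : unitInterval) else Kv f) =
        fun f => if f = eQ then Set.Icc.convexComb (KPf eQ) 1 v else KPf f := by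
      rw [hglueP Kv]; funext f
      by_cases hf : f = eQ
      · rw [if_pos hf, hf, if_neg hPQne.symm]
        simp only [hKv, hKPf, if_true, if_neg hPQne.symm]
      · rw [if_neg hf]
        by_cases hf2 : f = eP
        · rw [if_pos hf2]; simp only [hKPf, if_pos hf2]
        · rw [if_neg hf2]; simp only [hKv, hKPf, if_neg hf, if_neg hf2]
    have e2 : (fun f : Sym2 (Fin n) => if f = eQ then (1 : unitInterval) else KPf f) = KPQf := by
      funext f
      by_cases h1' : f = eQ
      · rw [if_pos h1']; simp only [hKPQf, h1', if_neg hPQne.symm, if_true]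
      · rw [if_neg h1']; simp only [hKPf, hKPQf, if_neg h1']
    rw [e1, real_raisePair_eq_mix, e2]
  have hyp' : 0 ≤ (1 - (u : ℝ)) * ((prodBernoulli Kv).real (openConn q b) - (prodBernoulli Kv).real (openConn j b)) +
      (u : ℝ) * ((prodBernoulli (fun f : Sym2 (Fin n) => if (∀ x ∈ f, x ∈ P) ∧ ¬ f.IsDiag then 1 else Kv f)).real (openConn q b) -
        (prodBernoulli (fun f : Sym2 (Fin n) => if (∀ x ∈ f, x ∈ P) ∧ ¬ f.IsDiag then 1 else Kv f)).real (openConn j b)) := by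
    rw [hsplit0, hsplit0, hsplitP, hsplitP]
    nlinarith [hrow]
  have key := twoAtomGlue Kv P q j b p₁ hp₁P hqP (u.2.1) (u.2.2) hyp'
  -- the glue pair of the lemma is `eQ` itself: the glued weighting is `KPQf`, independent of `v`
  have e3 : (fun f : Sym2 (Fin n) => if f = s(q, p₁) then (1 : unitInterval) else
      (if (∀ x ∈ f, x ∈ P) ∧ ¬ f.IsDiag then 1 else Kv f)) = KPQf := by
    funext f
    have hcl : (if (∀ x ∈ f, x ∈ P) ∧ ¬ f.IsDiag then (1 : unitInterval) else Kv f) = if f = eP then 1 else Kv f :=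
      congrFun (hglueP Kv) f
    rw [hcl, show s(q, p₁) = eQ by rw [heQ, Sym2.eq_swap]]
    by_cases hq' : f = eQ
    · rw [if_pos hq']; simp only [hKPQf, hq', if_neg hPQne.symm, if_true]
    · rw [if_neg hq']
      by_cases hp' : f = eP
      · rw [if_pos hp']; simp only [hKPQf, if_pos hp']
      · rw [if_neg hp']; simp only [hKv, hKPQf, if_neg hq', if_neg hp']
  rw [e3] at key
  -- forced-star evaluations
  have hG1 : G {q} = (prodBernoulli K).real (openConn q b) - (prodBernoulli K).real (openConn j b) := by
    have h := forcedMargin_eq K o b j hisoK hbo hjo {q} (by simp [hoq]) q (by simp) ∅ (by simp) (by simp)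
    rw [hG, h]; simp
  have hG2 : G {q, p₁} = (prodBernoulli KQf).real (openConn q b) - (prodBernoulli KQf).real (openConn j b) := by
    have h := forcedMargin_eq K o b j hisoK hbo hjo {q, p₁} (by simp [hop₁, hoq]) q (by simp) {eQ}
      (by intro e he x hx; rw [Finset.mem_singleton] at he; subst he; rw [heQ] at hx
          rcases Sym2.mem_iff.1 hx with rfl | rfl <;> simp)
      (by intro t ht; simp only [Finset.mem_insert, Finset.mem_singleton] at ht
          rcases ht with rfl | rfl
          · exact Or.inl rfl
          · exact Or.inr (Or.inl (by rw [heQ, Sym2.eq_swap]; simp)))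
    rw [hG, h]; simp [hKQf]
  have hG3 : G {q, p₁, p₂} = (prodBernoulli KPQf).real (openConn q b) - (prodBernoulli KPQf).real (openConn j b) := by
    have h := forcedMargin_eq K o b j hisoK hbo hjo {q, p₁, p₂} (by simp [hop₁, hop₂, hoq]) q (by simp) {eP, eQ}
      (by intro e he x hx; simp only [Finset.mem_insert, Finset.mem_singleton] at he
          rcases he with rfl | rfl
          · rw [heP] at hx; rcases Sym2.mem_iff.1 hx with rfl | rfl <;> simp
          · rw [heQ] at hx; rcases Sym2.mem_iff.1 hx with rfl | rfl <;> simp)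
      (by intro t ht; simp only [Finset.mem_insert, Finset.mem_singleton] at ht
          rcases ht with rfl | rfl | rfl
          · exact Or.inl rfl
          · exact Or.inr (Or.inl (by rw [heQ, Sym2.eq_swap]; simp))
          · exact Or.inr (Or.inr ⟨p₁, h1, hp, by rw [heQ, Sym2.eq_swap]; simp, by rw [heP]; simp⟩))
    have e : (fun f : Sym2 (Fin n) => if f ∈ ({eP, eQ} : Finset (Sym2 (Fin n))) then (1 : unitInterval) else K f) = KPQf := by
      funext f; simp only [hKPQf, Finset.mem_insert, Finset.mem_singleton]
      by_cases h1' : f = eP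
      · simp [h1']
      · by_cases h2' : f = eQ
        · simp [h2', hPQne.symm]
        · simp [h1', h2']
    rw [hG, h, e]
  rw [hG1, hG2, hG3]
  rw [hsplit0, hsplit0] at key
  nlinarith [key]

/-- **Shared-port FORMAL×FORMAL corner at goodness strength.**  See the module docstring. [cite: KozmaNitzan2024, Lemma 5 (p. 13), §3.2 (p. 12)] -/
theorem ffCornerShared (K : Sym2 (Fin n) → unitInterval) (o p₁ p₂ q j r b : Fin n) (u v : unitInterval)
    (hp : p₁ ≠ p₂) (h1 : p₁ ≠ q) (h2 : p₂ ≠ q) (hop₁ : o ≠ p₁) (hop₂ : o ≠ p₂) (hoq : o ≠ q) (hjo : j ≠ o) (hbo : b ≠ o)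
    (hisoK : ∀ u' : Fin n, u' ≠ o → K s(o, u') = 0)
    (G : Finset (Fin n) → ℝ)
    (hG : ∀ T : Finset (Fin n), G T =
      (prodBernoulli (fun f : Sym2 (Fin n) => if f ∈ T.image (fun t => s(o, t)) then 1 else K f)).real (openConn o b) -
        (prodBernoulli (fun f : Sym2 (Fin n) => if f ∈ T.image (fun t => s(o, t)) then 1 else K f)).real (openConn j b))
    (hrP : (prodBernoulli K).real (openConn r b) ≤ (prodBernoulli K).real (openConn p₁ b))
    (hrow : 0 ≤ (1 - (u : ℝ)) * (1 - (v : ℝ)) * ((prodBernoulli K).real (openConn r b) - (prodBernoulli K).real (openConn j b)) +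
      (u : ℝ) * (1 - (v : ℝ)) * ((prodBernoulli (fun f : Sym2 (Fin n) => if f = s(p₁, p₂) then 1 else K f)).real (openConn r b) -
        (prodBernoulli (fun f : Sym2 (Fin n) => if f = s(p₁, p₂) then 1 else K f)).real (openConn j b)) +
      (1 - (u : ℝ)) * (v : ℝ) * ((prodBernoulli (fun f : Sym2 (Fin n) => if f = s(p₁, q) then 1 else K f)).real (openConn r b) -
        (prodBernoulli (fun f : Sym2 (Fin n) => if f = s(p₁, q) then 1 else K f)).real (openConn j b)) +
      (u : ℝ) * (v : ℝ) * ((prodBernoulli (fun f : Sym2 (Fin n) => if f = s(p₁, p₂) then 1 else if f = s(p₁, q) then 1 else K f)).real (openConn r b) -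
        (prodBernoulli (fun f : Sym2 (Fin n) => if f = s(p₁, p₂) then 1 else if f = s(p₁, q) then 1 else K f)).real (openConn j b))) :
    0 ≤ (1 - (u : ℝ)) * (1 - (v : ℝ)) * ((prodBernoulli K).real (openConn r b) - (prodBernoulli K).real (openConn j b)) +
      (u : ℝ) * (1 - (v : ℝ)) * G {p₁, p₂} + (1 - (u : ℝ)) * (v : ℝ) * G {p₁, q} + (u : ℝ) * (v : ℝ) * G {q, p₁, p₂} := by
  set eP : Sym2 (Fin n) := s(p₁, p₂) with heP
  set eQ : Sym2 (Fin n) := s(p₁, q) with heQ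
  have hPQne : eP ≠ eQ := fun h => h2 (Sym2.congr_right.1 (heP ▸ heQ ▸ h))
  set KP : Sym2 (Fin n) → unitInterval := fun f => if f = eP then 1 else K f with hKP
  set KQ : Sym2 (Fin n) → unitInterval := fun f => if f = eQ then 1 else K f with hKQ
  set KPQ : Sym2 (Fin n) → unitInterval := fun f => if f = eP then 1 else if f = eQ then 1 else K f with hKPQ
  -- gluing transfers from `r ≤_K p₁`
  have hupdP : Function.update K s(p₂, p₁) 1 = KP := by
    funext f; rw [Function.update_apply, hKP]; simp only [heP]; rw [Sym2.eq_swap]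
  have hupdQ : Function.update K s(q, p₁) 1 = KQ := by
    funext f; rw [Function.update_apply, hKQ]; simp only [heQ]; rw [Sym2.eq_swap]
  have hupdPQ : Function.update KP s(q, p₁) 1 = KPQ := by
    funext f; rw [Function.update_apply, hKPQ, hKP]; simp only [heQ, heP]
    by_cases hf : f = s(q, p₁)
    · rw [if_pos hf, hf, Sym2.eq_swap, if_pos rfl, if_neg]
      · exact fun h => hPQne.symm (by rw [heP, heQ]; rw [Sym2.eq_swap] at h ⊢; exact h.symm ▸ rfl)
    · rw [if_neg hf]
      have : f ≠ s(p₁, q) := fun h => hf (by rw [h, Sym2.eq_swap])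
      rw [if_neg this]
  have tP : (prodBernoulli KP).real (openConn r b) ≤ (prodBernoulli KP).real (openConn p₁ b) := by
    have h := glueTransfer_openConn K p₂ p₁ r b hp.symm hrP
    rw [hupdP] at h
    have h' := real_openConn_update_one_glued K p₂ p₁ b hp.symm
    rw [hupdP] at h'
    rw [h']; exact h
  have tQ : (prodBernoulli KQ).real (openConn r b) ≤ (prodBernoulli KQ).real (openConn p₁ b) := by
    have h := glueTransfer_openConn K q p₁ r b h1.symm hrP
    rw [hupdQ] at h
    have h' := real_openConn_update_one_glued K q p₁ b h1.symm
    rw [hupdQ] at h'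
    rw [h']; exact h
  have tPQ : (prodBernoulli KPQ).real (openConn r b) ≤ (prodBernoulli KPQ).real (openConn p₁ b) := by
    have h := glueTransfer_openConn KP q p₁ r b h1.symm tP
    rw [hupdPQ] at h
    have h' := real_openConn_update_one_glued KP q p₁ b h1.symm
    rw [hupdPQ] at h'
    rw [h']; exact h
  -- forced-star evaluations (margins of `p₁`)
  have hG1 : G {p₁, p₂} = (prodBernoulli KP).real (openConn p₁ b) - (prodBernoulli KP).real (openConn j b) := by
    have h := forcedMargin_eq K o b j hisoK hbo hjo {p₁, p₂} (by simp [hop₁, hop₂]) p₁ (by simp) {eP}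
      (by intro e he x hx; rw [Finset.mem_singleton] at he; subst he; rw [heP] at hx
          rcases Sym2.mem_iff.1 hx with rfl | rfl <;> simp)
      (by intro t ht; simp only [Finset.mem_insert, Finset.mem_singleton] at ht
          rcases ht with rfl | rfl
          · exact Or.inl rfl
          · exact Or.inr (Or.inl (by rw [heP]; simp)))
    rw [hG, h]; simp [hKP]
  have hG2 : G {p₁, q} = (prodBernoulli KQ).real (openConn p₁ b) - (prodBernoulli KQ).real (openConn j b) := by
    have h := forcedMargin_eq K o b j hisoK hbo hjo {p₁, q} (by simp [hop₁, hoq]) p₁ (by simp) {eQ}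
      (by intro e he x hx; rw [Finset.mem_singleton] at he; subst he; rw [heQ] at hx
          rcases Sym2.mem_iff.1 hx with rfl | rfl <;> simp)
      (by intro t ht; simp only [Finset.mem_insert, Finset.mem_singleton] at ht
          rcases ht with rfl | rfl
          · exact Or.inl rfl
          · exact Or.inr (Or.inl (by rw [heQ]; simp)))
    rw [hG, h]; simp [hKQ]
  have hG3 : G {q, p₁, p₂} = (prodBernoulli KPQ).real (openConn p₁ b) - (prodBernoulli KPQ).real (openConn j b) := by
    have h := forcedMargin_eq K o b j hisoK hbo hjo {q, p₁, p₂} (by simp [hop₁, hop₂, hoq]) p₁ (by simp) {eP, eQ}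
      (by intro e he x hx; simp only [Finset.mem_insert, Finset.mem_singleton] at he
          rcases he with rfl | rfl
          · rw [heP] at hx; rcases Sym2.mem_iff.1 hx with rfl | rfl <;> simp
          · rw [heQ] at hx; rcases Sym2.mem_iff.1 hx with rfl | rfl <;> simp)
      (by intro t ht; simp only [Finset.mem_insert, Finset.mem_singleton] at ht
          rcases ht with rfl | rfl | rfl
          · exact Or.inr (Or.inl (by rw [heQ]; simp))
          · exact Or.inl rfl
          · exact Or.inr (Or.inl (by rw [heP]; simp)))
    have e : (fun f : Sym2 (Fin n) => if f ∈ ({eP, eQ} : Finset (Sym2 (Fin n))) then (1 : unitInterval) else K f) = KPQ := by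
      funext f; simp only [hKPQ, Finset.mem_insert, Finset.mem_singleton]
      by_cases h1' : f = eP
      · simp [h1']
      · by_cases h2' : f = eQ
        · simp [h2', hPQne.symm]
        · simp [h1', h2']
    rw [hG, h, e]
  rw [hG1, hG2, hG3]
  have c1 : 0 ≤ (u : ℝ) * (1 - (v : ℝ)) := mul_nonneg u.2.1 (sub_nonneg.2 v.2.2)
  have c2 : 0 ≤ (1 - (u : ℝ)) * (v : ℝ) := mul_nonneg (sub_nonneg.2 u.2.2) v.2.1
  have c3 : 0 ≤ (u : ℝ) * (v : ℝ) := mul_nonneg u.2.1 v.2.1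
  have d1 := mul_nonneg c1 (sub_nonneg.2 tP)
  have d2 := mul_nonneg c2 (sub_nonneg.2 tQ)
  have d3 := mul_nonneg c3 (sub_nonneg.2 tPQ)
  nlinarith [hrow, d1, d2, d3]

end KNGoodTwoTwo

end

end Summit.CriticalPhenomena.PercolationContinuityZ3.Theorems
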